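import Literature.MathematicalPhysics.StatisticalMechanics.HcpSiteGeometry
import HarnessLib

/-!
# `IsometryAtoms.MinimisingLawsHaveAtoms` (stmt-AtomisticToContinuum-15776), line `IdeatorOneSketch`:
# stub `stub_hcpCovering`

**Covering bound for relaxed hcp.** For `0 < a` and `39/50 · a ≤ h ≤ 17/20 · a`, every point of
`ℝ³` is within `11a/5` of a point of the relaxed hexagonal close packing `hcpStacking a h`
(`BarlowStacking.lean`).  The bound is deliberately loose (the true covering radius is `< a`); it
is the covering hypothesis consumed by the generic exact local theorem of the line.

Proof. `HcpSiteGeometry.exists_hcp_site_near` gives a site at squared distance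
`≤ 3a²/4 + h²`; on the box `h² ≤ (17/20)² a²`, so `3a²/4 + h² ≤ 589/400 · a² ≤ (11/5)² a²`.
All routine ([folklore]; J. H. Conway, N. J. A. Sloane, *Sphere Packings, Lattices and Groups*,
Ch. 1 §1.3 for the hcp point set).
-/

noncomputable section

namespace Summit.AtomisticToContinuum.Crystallization.Theorems.IsometryAtomsMinimisingLawsHaveAtoms

open Literature.MathematicalPhysics.StatisticalMechanics

/-- On the parameter box `h ≤ 17/20 · a` (with `0 ≤ h`) the crude squared covering radius
`3a²/4 + h²` is at most `(11/5 · a)²`. [folklore] -/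
theorem hcpCovering_sq_le {a h : ℝ} (hh₀ : 0 ≤ h) (hh₂ : h ≤ 17 / 20 * a) :
    3 / 4 * a ^ 2 + h ^ 2 ≤ (11 / 5 * a) ^ 2 := by
  have hsq : h ^ 2 ≤ (17 / 20 * a) ^ 2 := pow_le_pow_left₀ hh₀ hh₂ 2
  nlinarith [sq_nonneg a]

/-- **Stub `stub_hcpCovering` of line `IdeatorOneSketch`: covering bound for relaxed hcp.**
For `0 < a` and `39/50 · a ≤ h ≤ 17/20 · a`, every point `z` of `ℝ³` has a point `y` of
`hcpStacking a h` with `dist z y ≤ 11/5 · a` (`exists_hcp_site_near`: some site at squared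
distance `≤ 3a²/4 + h² ≤ (11/5 · a)²`). [folklore] -/
theorem stub_hcpCovering : ∀ a h : ℝ, 0 < a → 39 / 50 * a ≤ h → h ≤ 17 / 20 * a →
    ∀ z : EuclideanSpace ℝ (Fin 3), ∃ y ∈ hcpStacking a h, dist z y ≤ 11 / 5 * a := by
  intro a h ha hh₁ hh₂ z
  have hh : 0 < h := by linarith
  obtain ⟨y, hy, hd⟩ := exists_hcp_site_near ha.ne' hh.ne' z
  refine ⟨y, hy, ?_⟩
  have hsq : dist z y ^ 2 ≤ (11 / 5 * a) ^ 2 := hd.trans (hcpCovering_sq_le hh.le hh₂)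
  exact le_of_pow_le_pow_left₀ two_ne_zero (by positivity) hsq

end Summit.AtomisticToContinuum.Crystallization.Theorems.IsometryAtomsMinimisingLawsHaveAtoms

end
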